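import Summits.BirchSwinnertonDyer.BirchSwinnertonDyer.Theses.UniversalToricDescent
import Summits.BirchSwinnertonDyer.BirchSwinnertonDyer.Theorems.UniversalToricDescentTwinAlgMuZeroAtThreeOfBetaRoadParam
import Literature.NumberTheory.EllipticCurves.HeegnerNormPointExistenceAnyConductorProofs
import Literature.NumberTheory.EllipticCurves.HeegnerPointsProofs
import Literature.NumberTheory.EllipticCurves.HeegnerModuleIndex
import Literature.NumberTheory.EllipticCurves.PadicLogFiniteExtension
import HarnessLib

/-!
# Crux r205 `TwinAlgMuZeroAtThree` (stmt-BirchSwinnertonDyer-24737) — node `transcendence-torsion` (crux-ideate g17, 2026-08-31)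

Informally the crux says: for a twin `E′/ℚ` at `p = 3` (bucket B: multiplicative très ramifié `3 ∤ v₃(Δ_min)`;
bucket C₀: good supersingular, `a₃ = 0`), `ρ̄₃` onto, `K` Heegner of odd discriminant with `3 = 𝔭𝔭′` split, the
strict-at-`𝔭′` / relaxed-at-`𝔭` anticyclotomic dual Selmer group `X = XAc (E′/K) 3 κ 𝔭′ ∅ γ` is (TORS) `Λ`-torsion
and (MU) has `μ = 0`.

## The lever (row 26 of the KEEP/KILL table; technique class: TWISTED-LOGARITHM CHARACTER COUNT at the two places above 3 — finite-layer Poitou–Tate + Mazur/CV + Nekovář; transcendence-grade in general (BSW 2026 / analytic subgroup theorem), elementary at `p = 3` split)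

TORS, in BOTH buckets at once, from FINITE LAYERS and the COUNT of characters visible to the twisted `3`-adic logarithms
at the two places `𝔭`, `𝔭′` (a transcendence-grade statement in general, elementary here) — no `Λ`-adic class, no
norm-compatibility (so the `a₃ = 0` trace degeneracy of C₀ is irrelevant), no Weierstrass preparation, no explicit
reciprocity law / Coleman map / `L`-value, no ordinary isotropy, no local theory at `3` beyond `E′(K_{∞,w})[3] = 0`.
With `S_n := Sel_(∅ at 𝔭, 0 at 𝔭′)(K_n, E′[3^∞])`, two Poitou–Tate comparisons (`ℱ₁ = (f,0) ≤ ℱ_cl` and `ℱ₁ ≤ ℱ₂ = (∅,0)`,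
dual structures `(f,∅)`, `(0,∅)` on `T₃E′`) give
  `corank S_n ≤ (r_n + s_n − c_n(𝔭′)) + (3ⁿ − c_n(𝔭))`,
`r_n = rank E′(K_n)`, `s_n = corank Ш(E′/K_n)[3^∞]`, `c_n(v) = ℤ₃-rank of the 3-adic closure of E′(K_n)` in
`⊕_{w ∣ v} E′(K_{n,w})` `= #{χ ∈ Ĝ_n : ∑_g χ(g) log_ω(ι_v(g P)) ≠ 0 for some P}` (normal basis `K_n ⊗_K K_v ≅ ℚ₃[G_n]`,
finite Fourier inversion). Three printed theorems feed it:
* (T1) MAZUR — cofinitely many layers are good: `(c − 1) z_{n+1}` non-torsion for `c` generating `Gal(K_{n+1}/K_n)`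
  (Cornut–Vatsal 2007 Thm. 1.10 / 4.10; at C₀ the tree fact `CornutVatsal2007.thm110_exists_heegnerCharSum_ne_zero`, `3 ∤ N′`,
  plus `∃ → ∀` by `Aut(ℂ)`-transitivity on primitive characters; at B Thm. 4.1 / Lemma 4.9 with `δ = 1`);
* (T2) NEKOVÁŘ 2007 Thm. 3.2 (every prime, every conductor, (⋆) = non-CM): good `χ` ⟹ `rank E′(K_{n+1})^χ = 1` and
  `Ш^χ[3^∞]` finite — typed as the corank jump `Sel_{3^∞}(K_{n+1}) − Sel_{3^∞}(K_n) ≤ 2·3ⁿ`;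
* (T3) TWISTED LOGARITHMS — Burungale–Skinner–Wan 2026 Thm. 2.8(ii) (`A₀ = E′/ℚ`, `L = F = ℚ`, `E = ℚ(μ_{3^{n+1}})` CM,
  `H = K_{n+1}` abelian over `K`, non-CM from `ρ̄₃` onto; underlying tool the `p`-adic analytic subgroup theorem,
  Matev 2010 / Fuchs–Pham 2015): the `χ`-twisted `3`-adic logarithm `∑_i χ(γ^i) log_ω(ι₃(γ^i z))` of a good point is
  non-zero for EVERY embedding `ι₃` — hence `c_n(𝔭), c_n(𝔭′) ≥ #{good χ}`. In the crux's own setting this is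
  ELEMENTARY (found this generation): `ker log_ω = torsion` + orthogonality of roots of unity give ONE good primitive
  sum per place, and local Galois transport — `Gal(ℚ₃(μ_{3^{n+1}})/ℚ₃) = (ℤ/3^{n+1})^×` because `3` is totally ramified
  in `ℚ(μ_{3^∞})`, and `K_𝔭 = K_𝔭′ = ℚ₃` — carries it to ALL primitive characters;
and the glue (T4): `corank S_n ≤ ∑_{bad χ}(corank Sel^χ + 1) = O(1)` + exact control `S_n = Sel_ℱ₂(K_∞)^{Γ_n}` up to
bounded error (`E′(K_{∞,w})[3] = 0` for `w ∣ 3`: B — Tate curve, `μ₃ ⊄ K_{∞,w}`, `q ∉ (ℚ₃^×)³` because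
`3 ∤ v₃(q) = v₃(Δ_min)`, which is EXACTLY the crux's très-ramifié hypothesis; C₀ — `ρ̄₃|_{I₃}` of level 2, image of order
8 prime to 3) ⟹ `rank_{ℤ₃} X_{Γ_n} = O(1) < 3ⁿ` ⟹ `X` is `Λ`-torsion. MU is NOT touched (Baker-type bounds are
exponential in `3ⁿ` and cannot see `μ`): it is handed to the leaves MU_B ∣ TORS (rows 1/17/18/21/23) and MU_C₀ ∣ TORS
(rows 5/11, signed frame).

## Pieces and tags (evidence = the theorems of §5)
* `MazurLayerAtThree`            (T1)  WEAKER (port; bucket-uniform form of row 24's MAZUR_B)      — leaf ATTACKABLE (port, M)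
* `SelmerGrowthLeAtGoodLayerAtThree` (T2) WEAKER (port of Nekovář Thm. 3.2 + descent)            — leaf ATTACKABLE (port, L)
* `TwistedHeegnerLogNeZeroAtThree` (T3) KNOWN IN PRINT (BSW 2026 Thm. 2.8(ii)) AND elementary here     — leaf ATTACKABLE (in-tree, M–L: log-kernel + orthogonality + local Galois transport)
* `TorsionOfTranscendenceAtThree` (T4)  UNDECIDED as an implication; every step folklore PT/control — leaf ATTACKABLE (M–L)
* `TwinSelmerTorsionAtThree`      (TORS, derived `tors_of`) WEAKER than the crux (`tors_of_crux`)
* `TwinMuZeroOfTorsionMultAtThree` / `TwinMuZeroOfTorsionGoodSSAtThree` (MU ∣ TORS) UNDECIDED, COSTUME-adjacent (declared):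
  the `μ`-question itself — leaves IDEA-NEEDED (owners: rows 1/17/18/21/23 resp. 5/11).
`TwinAlgMuZeroAtThree_of` concludes the crux BY NAME from the six stubs; `sorry` occurs only in `stub_*`. §6 kernel-checks the counting
step of T4 (`corank_le_of_transcendence`), the primitive-component algebra (`eigenvector_eq_zero_of_fixed`) and step (1) of the
elementary T3 (`inversion`, `periodic_of_primitive_twisted_sums_eq_zero`: all primitive twisted sums zero ⟹ `3ⁿ`-periodic).

Disproof used: honours `twinAlgMuZeroAtThree_false_without_heegner` — Heegner points are load-bearing in T1, T2, T3
(the family `F` is produced from the crux binder `Dt'` and the Heegner hypothesis in `tors_of`). Negatives 24881 / 15532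
not touched. Instrument data: none new (kit 0); habitats 15a1/ℚ(√−11) (B), 17a1/ℚ(√−35) (C₀) as in `PICKED.md`.
-/

noncomputable section

open scoped Classical NumberField

set_option linter.dupNamespace false
set_option autoImplicit false

namespace Summit.BirchSwinnertonDyer.BirchSwinnertonDyer.Cruxes.TwinAlgMuZeroAtThree.TranscendenceTorsion

open NumberField IsDedekindDomain Field WeierstrassCurve Finset
open Literature.NumberTheory.EllipticCurves Literature.NumberTheory.EllipticCurves.IwasawaAlgebra
open Literature.NumberTheory.EllipticCurves.ZpExtension Literature.NumberTheory.EllipticCurves.GreenbergSelmer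
open Literature.NumberTheory.EllipticCurves.ModularForms
open Summit.BirchSwinnertonDyer.Rank1Residual.X11b Summit.BirchSwinnertonDyer.Rank1Residual.X11b.AcSelmer
open Summit.BirchSwinnertonDyer.BirchSwinnertonDyer.Theorems

/-! ## §1 The pieces -/

/-- **T1 · MAZUR (bucket-uniform) — cofinitely many layers of the anticyclotomic tower are good** (stub; WEAKER; port):
for every Heegner family `F` along `κ` (conductor `3^{n+1}` norm points `z_{n+1} ∈ E′(K_{n+1})`, which exist at EVERY
conductor, `exists_heegnerFamily_Dt_eq_of_dvd_sq_sub`) there is `n₀` with `(c − 1)·z_{n+1}` non-torsion for all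
`n ≥ n₀` and every `c ∈ Gal(K̄/K_n) ∖ Gal(K̄/K_{n+1})` — equivalently `e_χ z_{n+1} ≠ 0` for every PRIMITIVE character
`χ` of `Gal(K_{n+1}/K)` (the `Φ_{3^{n+1}}`-isotypic component of `z_{n+1}` in `E′(K_{n+1}) ⊗ ℚ` is
`ker`-complementary to `E′(K_n) ⊗ ℚ = ker(c − 1)`). C₀ (`3 ∤ N′`): Cornut–Vatsal Thm. 1.10 with `χ₀ = 1` — the
tree's named fact `CornutVatsal2007.thm110_exists_heegnerCharSum_ne_zero` gives ONE good `χ` per large level, and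
`Aut(ℂ/ℚ)` acts transitively on the primitive characters of the cyclic layer with `𝐚(x, σχ) = (1 ⊗ σ)𝐚(x, χ)`, so all
are good; B (`3 ∥ N′`): Thm. 4.1 / Lemma 4.9 (`δ = 1`), as row 24's `MazurLayerMultAtThree`. Why it might fail: only
as a PORT (the conductor-`3^{n+1}` points of `HeegnerFamily` must be matched with CV's good CM points; at B the level
structure at `3` is Eichler). [cite: CornutVatsal2007, Thm. 1.10, Thm. 4.1, Lemma 4.9, Thm. 4.10]
[cite: Nekovar2007Durham, (3.5.1)–(3.6)] -/
@[conjecture] def MazurLayerAtThree : Prop :=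
  ∀ (W' : WeierstrassCurve ℚ) [W'.IsElliptic] [W'.IsGloballyMinimal] (N' : ℕ) [NeZero N']
    (K : Type) [Field K] [NumberField K] (_Dt' : ModularParametrizationData W' N'),
    (Rank1Residual.Mult W' 3 ∧ ¬ 3 ∣ padicValInt 3 W'.minimalDiscriminantInt ∨
      Rank1Residual.GoodSS W' 3 ∧ W'.frobeniusTrace 3 = 0) →
    W'.HasSurjectiveModNGaloisRep 3 → W'.conductorNorm ℤ = N' → IsImaginaryQuadratic K →
    SatisfiesHeegnerHypothesis N' K → Odd (NumberField.discr K) →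
    ∀ (κ : ZpExtension K 3), κ.IsAnticyclotomic →
    ∀ (jbar : AlgebraicClosure K →+* ℂ) (F : HeegnerFamily N' W' K κ jbar),
      ∃ n₀ : ℕ, ∀ n : ℕ, n₀ ≤ n → ∀ c : absoluteGaloisGroup K,
        c ∈ κ.layerSubgroup n → c ∉ κ.layerSubgroup (n + 1) →
        ∀ m : ℤ, m ≠ 0 → m • (c • F.z (n + 1) - F.z (n + 1)) ≠ 0

/-- **T2 · NEKOVÁŘ — at a good layer the `3^∞`-Selmer corank jumps by at most `2·3ⁿ = φ(3^{n+1})`** (stub; WEAKER;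
port): if `(c − 1) z_{n+1}` is non-torsion (all primitive `χ` of level `n + 1` good), then
`#Sel_{3^k}(E′/K_{n+1}) ≤ C · 3^{2·3ⁿ·k} · #Sel_{3^k}(E′/K_n)` for all `k`, i.e.
`corank_{ℤ₃} Sel_{3^∞}(E′/K_{n+1}) − corank_{ℤ₃} Sel_{3^∞}(E′/K_n) ≤ 2·3ⁿ`: Nekovář 2007 Thm. 3.2 ("`y_χ ∉ A(H)_tors`
⟹ `(A(H) ⊗ 𝒪)^χ` has rank 1 and `(Ш(A/H) ⊗ 𝒪)^χ` is finite", for EVERY prime `𝔭` of `𝒪 = ℤ[χ]`, no condition on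
`p` or on the conductor; hypothesis (⋆) = `E′` non-CM, from `ρ̄₃` onto) summed over the `2·3ⁿ` primitive characters,
plus Galois descent `Sel_{3^∞}(K_n) → Sel_{3^∞}(K_{n+1})^{Gal}` (finite kernel/cokernel, `E′(K_∞)[3] = 0`). The finite
layer Selmer groups are the tree's `selmerTorsionOver` (Perrin-Riou's `S(L)^{(m)}`, `L = K̄^{layerSubgroup}`). Why it
might fail: only as a PORT (Nekovář's Euler-system argument at `p = 3` with `ρ̄₃` onto is inside his stated generality;
the passage corank ↔ `#Sel_{3^k}` growth is bookkeeping with `E′(K_{n+1})[3] = 0`).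
[cite: Nekovar2007Durham, Thm. 3.2] [cite: PerrinRiou1987BSMF, §0 p. 401] -/
@[conjecture] def SelmerGrowthLeAtGoodLayerAtThree : Prop :=
  ∀ (W' : WeierstrassCurve ℚ) [W'.IsElliptic] [W'.IsGloballyMinimal] (N' : ℕ) [NeZero N']
    (K : Type) [Field K] [NumberField K] (_Dt' : ModularParametrizationData W' N'),
    (Rank1Residual.Mult W' 3 ∧ ¬ 3 ∣ padicValInt 3 W'.minimalDiscriminantInt ∨
      Rank1Residual.GoodSS W' 3 ∧ W'.frobeniusTrace 3 = 0) →
    W'.HasSurjectiveModNGaloisRep 3 → W'.conductorNorm ℤ = N' → IsImaginaryQuadratic K →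
    SatisfiesHeegnerHypothesis N' K → Odd (NumberField.discr K) →
    ∀ (κ : ZpExtension K 3), κ.IsAnticyclotomic →
    ∀ (jbar : AlgebraicClosure K →+* ℂ) (F : HeegnerFamily N' W' K κ jbar) (n : ℕ),
      (∀ c : absoluteGaloisGroup K, c ∈ κ.layerSubgroup n → c ∉ κ.layerSubgroup (n + 1) →
        ∀ m : ℤ, m ≠ 0 → m • (c • F.z (n + 1) - F.z (n + 1)) ≠ 0) →
      ∃ C : ℕ, ∀ k : ℕ,
        Nat.card ((W'.baseChange K).selmerTorsionOver (κ.layerSubgroup (n + 1)) ((3 : ℤ) ^ k)) ≤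
          C * 3 ^ (2 * 3 ^ n * k) * Nat.card ((W'.baseChange K).selmerTorsionOver (κ.layerSubgroup n) ((3 : ℤ) ^ k))

/-- **T3 · TWISTED LOGARITHMS — the primitive-twisted `3`-adic logarithm of a good point does not vanish, for EVERY
embedding** (stub; KNOWN IN PRINT as a transcendence theorem, Burungale–Skinner–Wan 2026 Thm. 2.8(ii) — and, in the
crux's setting `K_𝔭 = K_𝔭′ = ℚ₃`, ELEMENTARY: (1) orthogonality of the `3^{n+1}`-th roots of unity + `ker log_ω = torsion`
(`FormalGroupChart.padicLogPointFiniteExt_eq_zero_iff_padicComplex`, `_add`) show that if ALL primitive sums vanished then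
`log_ω(ι₃(γ^j(γ^{3ⁿ} z − z))) = 0`, i.e. `(γ^{3ⁿ} − 1) z` torsion — excluded by the hypothesis; (2) TRANSPORT: for
`σ ∈ Aut_cont(ℂ₃/ℚ₃)`, `σ ∘ ι₃ = ι₃ ∘ h` with `h ∈ Gal(K̄/K)` (because `ι₃(K) ⊆ ℚ₃`, `3` split), `log_ω` is Galois-equivariant
(`padicLogPointFiniteExt_map_of_val_eq`) and `h` acts on `z ∈ E′(K_{n+1})` as `γ^t`, so `S(σζ) = σ(ζ)^{t}·σ(S(ζ))`; and
`Gal(ℚ₃(μ_{3^{n+1}})/ℚ₃) = (ℤ/3^{n+1})^×` — `3` is TOTALLY RAMIFIED in `ℚ(μ_{3^∞})` — is transitive on primitive roots, so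
ONE non-vanishing primitive sum gives ALL): `E′/ℚ` with `ρ̄₃` onto (so no CM over `ℚ̄`), `K` imaginary quadratic with
`3 = 𝔭𝔭′` split, `κ` a `ℤ₃`-extension with topological generator `γ`, `z ∈ E′(K_{n+1})` with
`(c − 1) z` non-torsion for the generators `c` of `Gal(K_{n+1}/K_n)` (⟺ `x_χ = ∑_τ τ(z) ⊗ χ(τ)` non-torsion for every
primitive `χ`, `χ(γ) = ζ` a primitive `3^{n+1}`-th root of unity); then for every `K`-embedding `ι₃ : K̄ → ℂ₃` (ANY
place above `3`) `∑_{i < 3^{n+1}} ζ^i · log_ω(ι₃(γ^i z)) ≠ 0`, `log_ω` the logarithm of the (integral, minimal) model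
over `ℂ₃` (`FormalGroupChart.padicLogPointFiniteExt`, kernel = torsion). BSW: `A₀ = E′`, `L = F = ℚ`,
`E = ℚ(μ_{3^{n+1}})` (CM), `H = K_{n+1}` abelian over `K`, case (ii); the engine is the `p`-adic analytic subgroup
theorem (Matev; Fuchs–Pham) — needed in print because for general `p` and `χ` the decomposition group at `p` in
`Gal(ℚ(χ)/ℚ)` is NOT transitive on the conjugates of `χ`; here it is. NOT implied by injectivity of a single logarithm
alone: the sum is the image of `(log ⊗ 1)(x_χ)` under the non-injective multiplication `K_{n+1,w} ⊗ ℚ(μ_{3^{n+1}}) → ℂ₃`;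
the extra input is exactly the transport (2). Why it might fail: as typed it is a theorem twice over (elementary route:
M–L Lean, plumbing = continuous extension of `σ` to `ℂ₃`, `IsAlgClosure` uniqueness for `σ ∘ ι₃ = ι₃ ∘ h`, irreducibility
of `Φ_{3^{n+1}}` over `ℚ₃` by Eisenstein); the integrality instance is dischargeable
(`WeierstrassCurve.isIntegral_of_exists_lift`, minimal model has integer coefficients) and is carried as a binder.
[cite: BurungaleSkinnerWan2026LogHeegner, Thm. 2.8(ii) (arXiv:2603.20886 p. 6), §1.5 (p. 4)] [cite: FuchsPham2015, Thm. 1]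
[cite: Matev2010arXiv1010.3156] -/
@[conjecture] def TwistedHeegnerLogNeZeroAtThree : Prop :=
  ∀ (W' : WeierstrassCurve ℚ) [W'.IsElliptic] [W'.IsGloballyMinimal], W'.HasSurjectiveModNGaloisRep 3 →
    ∀ (K : Type) [Field K] [NumberField K], IsImaginaryQuadratic K →
    ∀ (𝔭 : HeightOneSpectrum (𝓞 K)), ((3 : ℕ) : 𝓞 K) ∈ 𝔭.asIdeal →
      𝔭.asIdeal.ramificationIdx (𝓞 ℚ) = 1 → 𝔭.asIdeal.inertiaDeg (𝓞 ℚ) = 1 →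
    ∀ (𝔭' : HeightOneSpectrum (𝓞 K)), ((3 : ℕ) : 𝓞 K) ∈ 𝔭'.asIdeal → 𝔭' ≠ 𝔭 →
    ∀ (κ : ZpExtension K 3)
      (γ : absoluteGaloisGroup K) [Fact (κ.IsTopGenerator γ)]
      [Algebra K ℂ_[3]]
      [((W'.baseChange K).baseChange ℂ_[3]).IsIntegral (NormedField.valuation (K := ℂ_[3])).integer]
      (ι₃ : AlgebraicClosure K →ₐ[K] ℂ_[3]) (n : ℕ) (z : geomPoints (W'.baseChange K)),
      (∀ c : absoluteGaloisGroup K, c ∈ κ.layerSubgroup (n + 1) → c • z = z) →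
      (∀ c : absoluteGaloisGroup K, c ∈ κ.layerSubgroup n → c ∉ κ.layerSubgroup (n + 1) →
        ∀ m : ℤ, m ≠ 0 → m • (c • z - z) ≠ 0) →
      ∀ ζ : ℂ_[3], ζ ^ 3 ^ (n + 1) = 1 → ζ ^ 3 ^ n ≠ 1 →
        (∑ i ∈ Finset.range (3 ^ (n + 1)),
          ζ ^ i * FormalGroupChart.padicLogPointFiniteExt NormedField.valuation
            ((W'.baseChange K).baseChange ℂ_[3]) 3
            (WeierstrassCurve.Affine.Point.map ι₃ (γ ^ i • z) :
              ((W'.baseChange K).baseChange ℂ_[3]).toAffine.Point)) ≠ 0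

/-- **T4 · GLUE — torsion of `X_(∅,0)` from Mazur + Nekovář-growth + transcendence** (stub; the NEW piece; UNDECIDED as
an implication, every step folklore): for a Heegner family `F` with (i) `(c−1)z_{n+1}` non-torsion for `n ≥ n₀`,
(ii) the Selmer corank jump `≤ 2·3ⁿ` at every layer `n ≥ n₀`, (iii) the primitive-twisted logarithms of `z_{n+1}`
non-zero for every embedding `K̄ → ℂ₃` and `n ≥ n₀`, the dual Selmer group `XAc (E′/K) 3 κ 𝔭′ ∅ γ` is `Λ`-torsion.
Mechanism: `S_n = Sel_(∅ at 𝔭, 0 at 𝔭′)(K_n, E′[3^∞])`; Poitou–Tate twice: `corank S_n ≤ (r_n + s_n − c_n(𝔭′)) + (3ⁿ − c_n(𝔭))`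
with `c_n(v) = rank_{ℤ₃}` of the closure of `E′(K_n)` in `⊕_{w∣v} E′(K_{n,w})` `= #{χ : ∑_g χ(g) log(ι_v(g P)) ≠ 0 some P}`
(normal basis + Fourier); (iii) ⟹ `c_n(𝔭), c_n(𝔭′) ≥ #good χ`; (i)+(ii) ⟹ `r_n + s_n ≤ #good χ + O(1)`; so
`corank S_n = O(1)`; control: `H¹(K_n, A) = H¹(K_∞, A)^{Γ_n}` and `S_n = Sel_ℱ₂(K_∞)^{Γ_n}` up to a bounded finite group,
because `E′(K_∞)[3] = 0` (`ρ̄₃` onto) and `E′(K_{∞,w})[3] = 0` for `w ∣ 3` (B: Tate curve, `μ₃ ⊄ K_{∞,w}`,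
`q ∉ (ℚ₃^×)³` as `3 ∤ v₃(Δ_min)` — the très-ramifié hypothesis; C₀: `ρ̄₃|_{I₃}` fundamental of level 2); hence
`rank_{ℤ₃} X_{Γ_n} = O(1) < 3ⁿ`, and a `Λ`-module of positive rank has `rank X_{Γ_n} ≥ 3ⁿ`. Why it might fail: the
identification of `XAc`'s local conditions away from `3` (locally trivial over `K_∞`) with the classical ones at the
bad primes `v ∣ N′` of `K_n` (finite bounded error — Tamagawa numbers in a finitely decomposed tower; fine for coranks,
to be checked in the tree's `selmerOver`), and the `ℤ₃`-corank bookkeeping from `#Sel_{3^k}` bounds.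
[cite: PerrinRiou1987BSMF, §3 (reciprocity shape)] [cite: GreenbergLNM1716, §3 (control, shape)]
[cite: BurungaleSkinnerWan2026LogHeegner, §1.5 (dimension of p-adic closures; Poonen, Waldschmidt)] -/
@[conjecture] def TorsionOfTranscendenceAtThree : Prop :=
  ∀ (W' : WeierstrassCurve ℚ) [W'.IsElliptic] [W'.IsGloballyMinimal] (N' : ℕ) [NeZero N']
    (K : Type) [Field K] [NumberField K] (_Dt' : ModularParametrizationData W' N'),
    (Rank1Residual.Mult W' 3 ∧ ¬ 3 ∣ padicValInt 3 W'.minimalDiscriminantInt ∨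
      Rank1Residual.GoodSS W' 3 ∧ W'.frobeniusTrace 3 = 0) →
    W'.HasSurjectiveModNGaloisRep 3 → W'.conductorNorm ℤ = N' → IsImaginaryQuadratic K →
    SatisfiesHeegnerHypothesis N' K → Odd (NumberField.discr K) →
    ∀ (κ : ZpExtension K 3), κ.IsAnticyclotomic →
    ∀ (γ : absoluteGaloisGroup K) [Fact (κ.IsTopGenerator γ)]
      (𝔭 : HeightOneSpectrum (𝓞 K)), ((3 : ℕ) : 𝓞 K) ∈ 𝔭.asIdeal →
      𝔭.asIdeal.ramificationIdx (𝓞 ℚ) = 1 → 𝔭.asIdeal.inertiaDeg (𝓞 ℚ) = 1 →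
    ∀ (𝔭' : HeightOneSpectrum (𝓞 K)), ((3 : ℕ) : 𝓞 K) ∈ 𝔭'.asIdeal → 𝔭' ≠ 𝔭 →
    ∀ (jbar : AlgebraicClosure K →+* ℂ) (F : HeegnerFamily N' W' K κ jbar) (n₀ : ℕ),
      -- (i) MAZUR from `n₀` on
      (∀ n : ℕ, n₀ ≤ n → ∀ c : absoluteGaloisGroup K,
        c ∈ κ.layerSubgroup n → c ∉ κ.layerSubgroup (n + 1) →
        ∀ m : ℤ, m ≠ 0 → m • (c • F.z (n + 1) - F.z (n + 1)) ≠ 0) →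
      -- (ii) NEKOVÁŘ growth bound at every layer `n ≥ n₀`
      (∀ n : ℕ, n₀ ≤ n → ∃ C : ℕ, ∀ k : ℕ,
        Nat.card ((W'.baseChange K).selmerTorsionOver (κ.layerSubgroup (n + 1)) ((3 : ℤ) ^ k)) ≤
          C * 3 ^ (2 * 3 ^ n * k) *
            Nat.card ((W'.baseChange K).selmerTorsionOver (κ.layerSubgroup n) ((3 : ℤ) ^ k))) →
      -- (iii) TRANSCENDENCE: primitive-twisted logarithms of `z_{n+1}` non-zero for every embedding into `ℂ₃`
      (∀ n : ℕ, n₀ ≤ n → ∀ [Algebra K ℂ_[3]]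
        [((W'.baseChange K).baseChange ℂ_[3]).IsIntegral (NormedField.valuation (K := ℂ_[3])).integer]
        (ι₃ : AlgebraicClosure K →ₐ[K] ℂ_[3]) (ζ : ℂ_[3]), ζ ^ 3 ^ (n + 1) = 1 → ζ ^ 3 ^ n ≠ 1 →
        (∑ i ∈ Finset.range (3 ^ (n + 1)),
          ζ ^ i * FormalGroupChart.padicLogPointFiniteExt NormedField.valuation
            ((W'.baseChange K).baseChange ℂ_[3]) 3
            (WeierstrassCurve.Affine.Point.map ι₃ (γ ^ i • F.z (n + 1)) :
              ((W'.baseChange K).baseChange ℂ_[3]).toAffine.Point)) ≠ 0) →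
      Module.IsTorsion (IwasawaAlgebra 3) (XAc (W'.baseChange K) 3 κ 𝔭' ∅ γ)

/-- **TORS — the torsion conjunct of the crux, both buckets** (derived below from T1–T4 by `tors_of`; not a stub):
`X_(∅ at 𝔭, 0 at 𝔭′)(E′/K_∞)` is `Λ`-torsion. WEAKER than the crux (`tors_of_crux`); in bucket B implied by the line of
record (`torsMult_of_betaRoad`), in bucket C₀ by the shared leaf C₀′ (`torsGoodSS_of_goodSSOfParam`).
[cite: BertoliniDarmonPrasanna2013, (shape only)] [cite: Castella2024MathZ, Thm. 6.2 (shape only)] -/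
@[conjecture] def TwinSelmerTorsionAtThree : Prop :=
  ∀ (W' : WeierstrassCurve ℚ) [W'.IsElliptic] [W'.IsGloballyMinimal] (N' : ℕ) [NeZero N']
    (K : Type) [Field K] [NumberField K] (_Dt' : ModularParametrizationData W' N'),
    (Rank1Residual.Mult W' 3 ∧ ¬ 3 ∣ padicValInt 3 W'.minimalDiscriminantInt ∨
      Rank1Residual.GoodSS W' 3 ∧ W'.frobeniusTrace 3 = 0) →
    W'.HasSurjectiveModNGaloisRep 3 → W'.conductorNorm ℤ = N' → IsImaginaryQuadratic K →
    SatisfiesHeegnerHypothesis N' K → Odd (NumberField.discr K) →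
    ∀ (κ : ZpExtension K 3), κ.IsAnticyclotomic →
    ∀ (γ : absoluteGaloisGroup K) [Fact (κ.IsTopGenerator γ)]
      (𝔭 : HeightOneSpectrum (𝓞 K)), ((3 : ℕ) : 𝓞 K) ∈ 𝔭.asIdeal →
      𝔭.asIdeal.ramificationIdx (𝓞 ℚ) = 1 → 𝔭.asIdeal.inertiaDeg (𝓞 ℚ) = 1 →
    ∀ (𝔭' : HeightOneSpectrum (𝓞 K)), ((3 : ℕ) : 𝓞 K) ∈ 𝔭'.asIdeal → 𝔭' ≠ 𝔭 →
      Module.IsTorsion (IwasawaAlgebra 3) (XAc (W'.baseChange K) 3 κ 𝔭' ∅ γ)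

/-- **MU_B ∣ TORS — the residual `μ = 0` conjunct in bucket B, GIVEN torsion** (stub; UNDECIDED; NOT attacked by this
node — leaf IDEA-NEEDED, owners rows 1 / 17 / 18 / 21 / 23; same text as row 24's `MazurLogTorsion.TwinMuZeroOfTorsionMultAtThree`):
the characteristic ideal of `X_(∅,0)`, pushed to `𝒪^{nr}⟦T⟧`, is principal with a generator having a unit
coefficient. Why it might fail: this IS the `μ`-invariant question at `p = 3 ∥ N′` (no printed engine); declared
COSTUME-adjacent. [cite: Castella2024MathZ, Thm. 6.2 (shape only)] [cite: Howard2004HeegnerKolyvagin, Thm. B (shape only)] -/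
@[conjecture] def TwinMuZeroOfTorsionMultAtThree : Prop :=
  ∀ (W' : WeierstrassCurve ℚ) [W'.IsElliptic] [W'.IsGloballyMinimal] (N' : ℕ) [NeZero N']
    (K : Type) [Field K] [NumberField K] (_Dt' : ModularParametrizationData W' N'),
    Rank1Residual.Mult W' 3 → ¬ 3 ∣ padicValInt 3 W'.minimalDiscriminantInt →
    W'.HasSurjectiveModNGaloisRep 3 → W'.conductorNorm ℤ = N' → IsImaginaryQuadratic K →
    SatisfiesHeegnerHypothesis N' K → Odd (NumberField.discr K) →
    ∀ (κ : ZpExtension K 3), κ.IsAnticyclotomic →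
    ∀ (γ : absoluteGaloisGroup K) [Fact (κ.IsTopGenerator γ)]
      (𝔭 : HeightOneSpectrum (𝓞 K)), ((3 : ℕ) : 𝓞 K) ∈ 𝔭.asIdeal →
      𝔭.asIdeal.ramificationIdx (𝓞 ℚ) = 1 → 𝔭.asIdeal.inertiaDeg (𝓞 ℚ) = 1 →
    ∀ (𝔭' : HeightOneSpectrum (𝓞 K)), ((3 : ℕ) : 𝓞 K) ∈ 𝔭'.asIdeal → 𝔭' ≠ 𝔭 →
      Module.IsTorsion (IwasawaAlgebra 3) (XAc (W'.baseChange K) 3 κ 𝔭' ∅ γ) →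
      ∃ g' : UnrSeries 3,
        (XAc.charIdeal (W'.baseChange K) 3 κ 𝔭' ∅ γ).map (PowerSeries.map (Halves.toUnr 3)) =
            Ideal.span {g'} ∧
          ∃ i : ℕ, ‖((PowerSeries.coeff i g' : unrIntegers 3) : ℂ_[3])‖ = 1

/-- **MU_C₀ ∣ TORS — the residual `μ = 0` conjunct in bucket C₀ (good supersingular, `a₃ = 0`), GIVEN torsion** (stub;
UNDECIDED; NOT attacked by this node — leaf IDEA-NEEDED, owners rows 5 / 11 (signed `♯/♭` frame) and the shared leaf C₀′).
Why it might fail: the `μ`-invariant question for the BDP-type Selmer group at a supersingular prime (signed theory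
at `p = 3`, `a₃ = 0`, unrefereed in print); declared COSTUME-adjacent.
[cite: CastellaWan2016ss, (shape only)] [cite: Kobayashi2003, (shape only)] -/
@[conjecture] def TwinMuZeroOfTorsionGoodSSAtThree : Prop :=
  ∀ (W' : WeierstrassCurve ℚ) [W'.IsElliptic] [W'.IsGloballyMinimal] (N' : ℕ) [NeZero N']
    (K : Type) [Field K] [NumberField K] (_Dt' : ModularParametrizationData W' N'),
    Rank1Residual.GoodSS W' 3 → W'.frobeniusTrace 3 = 0 →
    W'.HasSurjectiveModNGaloisRep 3 → W'.conductorNorm ℤ = N' → IsImaginaryQuadratic K →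
    SatisfiesHeegnerHypothesis N' K → Odd (NumberField.discr K) →
    ∀ (κ : ZpExtension K 3), κ.IsAnticyclotomic →
    ∀ (γ : absoluteGaloisGroup K) [Fact (κ.IsTopGenerator γ)]
      (𝔭 : HeightOneSpectrum (𝓞 K)), ((3 : ℕ) : 𝓞 K) ∈ 𝔭.asIdeal →
      𝔭.asIdeal.ramificationIdx (𝓞 ℚ) = 1 → 𝔭.asIdeal.inertiaDeg (𝓞 ℚ) = 1 →
    ∀ (𝔭' : HeightOneSpectrum (𝓞 K)), ((3 : ℕ) : 𝓞 K) ∈ 𝔭'.asIdeal → 𝔭' ≠ 𝔭 →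
      Module.IsTorsion (IwasawaAlgebra 3) (XAc (W'.baseChange K) 3 κ 𝔭' ∅ γ) →
      ∃ g' : UnrSeries 3,
        (XAc.charIdeal (W'.baseChange K) 3 κ 𝔭' ∅ γ).map (PowerSeries.map (Halves.toUnr 3)) =
            Ideal.span {g'} ∧
          ∃ i : ℕ, ‖((PowerSeries.coeff i g' : unrIntegers 3) : ℂ_[3])‖ = 1

/-! ## §2 Registered stubs -/

theorem stub_mazurLayer : MazurLayerAtThree := by sorry
theorem stub_selmerGrowthLeAtGoodLayer : SelmerGrowthLeAtGoodLayerAtThree := by sorry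
theorem stub_twistedHeegnerLogNeZero : TwistedHeegnerLogNeZeroAtThree := by sorry
theorem stub_torsionOfTranscendence : TorsionOfTranscendenceAtThree := by sorry
theorem stub_muZeroOfTorsionMult : TwinMuZeroOfTorsionMultAtThree := by sorry
theorem stub_muZeroOfTorsionGoodSS : TwinMuZeroOfTorsionGoodSSAtThree := by sorry

/-! ## §3 The torsion conjunct from T1–T4 (kernel-checked composition; consumes `Dt'` and the Heegner hypothesis) -/

/-- **TORS from MAZUR, NEKOVÁŘ-growth, TRANSCENDENCE and the GLUE.** The Heegner family is supplied — at EVERY conductor,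
so uniformly in the bucket — by `exists_dvd_sq_sub_discr_holds` (orientation `β`, Heegner hypothesis) and
`exists_heegnerFamily_Dt_eq_of_dvd_sq_sub`; the `K_{n+1}`-rationality of `z_{n+1}` fed to T3 is
`IsHeegnerNormPoint.smul_eq_self`. -/
theorem tors_of (hM : MazurLayerAtThree) (hNk : SelmerGrowthLeAtGoodLayerAtThree)
    (hT : TwistedHeegnerLogNeZeroAtThree) (hG : TorsionOfTranscendenceAtThree) : TwinSelmerTorsionAtThree := by
  intro W' _ _ N' _ K _ _ Dt' hbucket hsurj hN hK hH hodd κ hκ γ hγ 𝔭 h𝔭 he hf 𝔭' h𝔭' hne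
  obtain ⟨ιC⟩ := (inferInstance : Nonempty (K →+* ℂ))
  letI : Algebra K ℂ := ιC.toAlgebra
  let jbar : AlgebraicClosure K →+* ℂ :=
    (IsAlgClosed.lift (R := K) (M := ℂ) (S := AlgebraicClosure K)).toRingHom
  obtain ⟨β, hβ⟩ := exists_dvd_sq_sub_discr_holds N' K hK hH
  obtain ⟨F, -, -⟩ := exists_heegnerFamily_Dt_eq_of_dvd_sq_sub hK κ Dt' hβ jbar
  obtain ⟨n₀, hn₀⟩ := hM W' N' K Dt' hbucket hsurj hN hK hH hodd κ hκ jbar F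
  refine hG W' N' K Dt' hbucket hsurj hN hK hH hodd κ hκ γ 𝔭 h𝔭 he hf 𝔭' h𝔭' hne jbar F n₀ hn₀
    (fun n hn ↦ hNk W' N' K Dt' hbucket hsurj hN hK hH hodd κ hκ jbar F n (hn₀ n hn)) ?_
  intro n hn _ _ ι₃ ζ h1 h2
  exact hT W' hsurj K hK 𝔭 h𝔭 he hf 𝔭' h𝔭' hne κ γ ι₃ n (F.z (n + 1))
    (fun c hc ↦ IsHeegnerNormPoint.smul_eq_self (F.isHeegnerNormPoint_z (n + 1)) hc) (hn₀ n hn) ζ h1 h2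

/-! ## §4 The node concludes the crux BY NAME -/

/-- **Composition**: T1–T4 (TORS, both buckets) + (MU_B ∣ TORS) + (MU_C₀ ∣ TORS) ⟹ crux r205 `TwinAlgMuZeroAtThree`
(literally the route decl). -/
theorem TwinAlgMuZeroAtThree_of
    (hM : MazurLayerAtThree) (hNk : SelmerGrowthLeAtGoodLayerAtThree) (hT : TwistedHeegnerLogNeZeroAtThree)
    (hG : TorsionOfTranscendenceAtThree)
    (hMuB : TwinMuZeroOfTorsionMultAtThree) (hMuC : TwinMuZeroOfTorsionGoodSSAtThree) :
    Summit.BirchSwinnertonDyer.BirchSwinnertonDyer.Theses.UniversalToricDescent.TwinAlgMuZeroAtThree := by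
  intro W' _ _ N' _ K _ _ Dt' hbucket hsurj hN hK hH hodd κ hκ γ _ 𝔭 h𝔭 he hf 𝔭' h𝔭' hne
  have hTors : Module.IsTorsion (IwasawaAlgebra 3) (XAc (W'.baseChange K) 3 κ 𝔭' ∅ γ) :=
    tors_of hM hNk hT hG W' N' K Dt' hbucket hsurj hN hK hH hodd κ hκ γ 𝔭 h𝔭 he hf 𝔭' h𝔭' hne
  rcases hbucket with ⟨hm, htr⟩ | ⟨hss, ha⟩
  · exact ⟨hTors, hMuB W' N' K Dt' hm htr hsurj hN hK hH hodd κ hκ γ 𝔭 h𝔭 he hf 𝔭' h𝔭' hne hTors⟩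
  · exact ⟨hTors, hMuC W' N' K Dt' hss ha hsurj hN hK hH hodd κ hκ γ 𝔭 h𝔭 he hf 𝔭' h𝔭' hne hTors⟩

/-- **The node closes the crux from its six stubs** (inherits their `sorry`s). -/
theorem TwinAlgMuZeroAtThree_of_stubs :
    Summit.BirchSwinnertonDyer.BirchSwinnertonDyer.Theses.UniversalToricDescent.TwinAlgMuZeroAtThree :=
  TwinAlgMuZeroAtThree_of stub_mazurLayer stub_selmerGrowthLeAtGoodLayer stub_twistedHeegnerLogNeZero
    stub_torsionOfTranscendence stub_muZeroOfTorsionMult stub_muZeroOfTorsionGoodSS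

/-! ## §5 Evidence: the pieces are WEAKER than the crux and implied by the lines of record -/

/-- TORS is the first conjunct of the crux (both buckets). -/
theorem tors_of_crux
    (h : Summit.BirchSwinnertonDyer.BirchSwinnertonDyer.Theses.UniversalToricDescent.TwinAlgMuZeroAtThree) :
    TwinSelmerTorsionAtThree := by
  intro W' _ _ N' _ K _ _ Dt' hbucket hsurj hN hK hH hodd κ hκ γ _ 𝔭 h𝔭 he hf 𝔭' h𝔭' hne
  exact (h W' N' K Dt' hbucket hsurj hN hK hH hodd κ hκ γ 𝔭 h𝔭 he hf 𝔭' h𝔭' hne).1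

/-- MU_B ∣ TORS is implied by the crux (drop the torsion hypothesis). -/
theorem muZeroOfTorsionMult_of_crux
    (h : Summit.BirchSwinnertonDyer.BirchSwinnertonDyer.Theses.UniversalToricDescent.TwinAlgMuZeroAtThree) :
    TwinMuZeroOfTorsionMultAtThree := by
  intro W' _ _ N' _ K _ _ Dt' hm htr hsurj hN hK hH hodd κ hκ γ _ 𝔭 h𝔭 he hf 𝔭' h𝔭' hne _
  exact (h W' N' K Dt' (Or.inl ⟨hm, htr⟩) hsurj hN hK hH hodd κ hκ γ 𝔭 h𝔭 he hf 𝔭' h𝔭' hne).2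

/-- MU_C₀ ∣ TORS is implied by the crux (drop the torsion hypothesis). -/
theorem muZeroOfTorsionGoodSS_of_crux
    (h : Summit.BirchSwinnertonDyer.BirchSwinnertonDyer.Theses.UniversalToricDescent.TwinAlgMuZeroAtThree) :
    TwinMuZeroOfTorsionGoodSSAtThree := by
  intro W' _ _ N' _ K _ _ Dt' hss ha hsurj hN hK hH hodd κ hκ γ _ 𝔭 h𝔭 he hf 𝔭' h𝔭' hne _
  exact (h W' N' K Dt' (Or.inr ⟨hss, ha⟩) hsurj hN hK hH hodd κ hκ γ 𝔭 h𝔭 he hf 𝔭' h𝔭' hne).2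

/-- TORS is implied by the line of record in BOTH buckets: β-road v19 (K1‴ ∧ K2a‴ ⟹ bucket-B text) and the shared
leaf C₀′ (`TwinAlgMuZeroAtThreeGoodSSOfParam` ⟺ bucket-C₀ text). -/
theorem tors_of_betaRoad
    (hK1 : UniversalToricDescentBetaRoadParamDefs.PrincipalHeegnerIndivisibleMultOfParamAtThree)
    (hK2 : UniversalToricDescentKsTwinLambdaDefs.KsTwinLambdaAdicAtThree)
    (hC0 : UniversalToricDescentBetaRoadParamDefs.TwinAlgMuZeroAtThreeGoodSSOfParam) :
    TwinSelmerTorsionAtThree := by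
  intro W' _ _ N' _ K _ _ Dt' hbucket hsurj hN hK hH hodd κ hκ γ _ 𝔭 h𝔭 he hf 𝔭' h𝔭' hne
  rcases hbucket with ⟨hm, htr⟩ | ⟨hss, ha⟩
  · exact (UniversalToricDescentTwinAlgMuZeroAtThreeOfBetaRoadParam.twinAlgMuZeroAtThree_mult_of_betaRoadParam
      hK1 hK2 W' N' K Dt' hm htr hsurj hN hK hH hodd κ hκ γ 𝔭 h𝔭 he hf 𝔭' h𝔭' hne).1
  · exact ((UniversalToricDescentBetaRoadParamDefs.twinAlgMuZeroAtThreeGoodSSOfParam_iff.mp hC0)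
      W' N' K Dt' hss ha hsurj hN hK hH hodd κ hκ γ 𝔭 h𝔭 he hf 𝔭' h𝔭' hne).1

/-- MU_B ∣ TORS is implied by the line of record (β-road v19). -/
theorem muZeroOfTorsionMult_of_betaRoad
    (hK1 : UniversalToricDescentBetaRoadParamDefs.PrincipalHeegnerIndivisibleMultOfParamAtThree)
    (hK2 : UniversalToricDescentKsTwinLambdaDefs.KsTwinLambdaAdicAtThree) :
    TwinMuZeroOfTorsionMultAtThree := by
  intro W' _ _ N' _ K _ _ Dt' hm htr hsurj hN hK hH hodd κ hκ γ _ 𝔭 h𝔭 he hf 𝔭' h𝔭' hne _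
  exact (UniversalToricDescentTwinAlgMuZeroAtThreeOfBetaRoadParam.twinAlgMuZeroAtThree_mult_of_betaRoadParam
    hK1 hK2 W' N' K Dt' hm htr hsurj hN hK hH hodd κ hκ γ 𝔭 h𝔭 he hf 𝔭' h𝔭' hne).2

/-- MU_C₀ ∣ TORS is implied by the shared leaf C₀′. -/
theorem muZeroOfTorsionGoodSS_of_goodSSOfParam
    (hC0 : UniversalToricDescentBetaRoadParamDefs.TwinAlgMuZeroAtThreeGoodSSOfParam) :
    TwinMuZeroOfTorsionGoodSSAtThree := by
  intro W' _ _ N' _ K _ _ Dt' hss ha hsurj hN hK hH hodd κ hκ γ _ 𝔭 h𝔭 he hf 𝔭' h𝔭' hne _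
  exact ((UniversalToricDescentBetaRoadParamDefs.twinAlgMuZeroAtThreeGoodSSOfParam_iff.mp hC0)
    W' N' K Dt' hss ha hsurj hN hK hH hodd κ hκ γ 𝔭 h𝔭 he hf 𝔭' h𝔭' hne).2

/-! ## §6 Kernel-checked pieces of the mechanism -/

/-- **The counting step of T4** (pure arithmetic, kernel-checked): if the Selmer corank at layer `n` is at most
`(r + s − c′) + (3ⁿ − c)` (the two Poitou–Tate inequalities), the Mordell–Weil-plus-Ш corank `r + s` is at most
`good + B` (Mazur + Nekovář: one per good character plus a bounded bad part) and both closure ranks `c, c′` are at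
least `good` (transcendence) with `good ≥ 3ⁿ − b` (cofinitely many good characters), then the corank is `≤ B + b`,
uniformly in `n`. -/
theorem corank_le_of_transcendence {n r s c c' good B b S : ℕ}
    (hS : S ≤ (r + s - c') + (3 ^ n - c)) (hrs : r + s ≤ good + B) (hc : good ≤ c) (hc' : good ≤ c')
    (hgood : 3 ^ n ≤ good + b) : S ≤ B + b := by
  omega

/-- **The primitive-component step of T1/T3** (the algebra, kernel-checked): in a torsion-free situation, if `c` acts on
an eigenvector `e` by a scalar `u` with `u − 1` invertible (a primitive cube root of unity `χ(c)` over `ℚ(χ)`), then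
`c • e = e` forces `e = 0` — so `(c − 1) z` torsion kills every primitive `χ`-component of `z`, and conversely a
non-torsion `(c − 1) z` is the non-vanishing of the primitive isotypic part. -/
theorem eigenvector_eq_zero_of_fixed {R M : Type*} [CommRing R] [AddCommGroup M] [Module R M]
    {u : R} (hu : IsUnit (u - 1)) {e : M} (hce : u • e = e) : e = 0 := by
  have h : (u - 1) • e = 0 := by rw [sub_smul, one_smul, hce, sub_self]
  obtain ⟨v, hv⟩ := hu
  have : v⁻¹.val • ((u - 1) • e) = 0 := by rw [h, smul_zero]
  rwa [← hv, smul_smul, Units.inv_mul, one_smul] at this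


/-! ### Step (1) of the elementary T3: Fourier inversion with a primitive root of unity in a field, and
«all PRIMITIVE twisted sums vanish ⟹ the function is `3ⁿ`-periodic» (applied to `j ↦ log_ω(ι₃(γ^j z))` this gives
`log_ω(ι₃(γ^j(γ^{3ⁿ} z − z))) = 0`, whence `(γ^{3ⁿ} − 1) z` torsion by `ker log_ω = torsion`). Kernel-checked, sorry-free. -/

section Orthogonality

open Finset

variable {R : Type*} [Field R]

theorem geom_sum_zpow_eq {N : ℕ} {ζ : R} (hζ : IsPrimitiveRoot ζ N) (k : ℤ) :
    ∑ a ∈ range N, (ζ ^ k) ^ a = if (N : ℤ) ∣ k then (N : R) else 0 := by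
  split_ifs with h
  · have h1 : ζ ^ k = 1 := (hζ.zpow_eq_one_iff_dvd k).mpr h
    simp [h1]
  · have hne : ζ ^ k ≠ 1 := fun h1 => h ((hζ.zpow_eq_one_iff_dvd k).mp h1)
    rw [geom_sum_eq hne]
    have hpow : (ζ ^ k) ^ N = 1 := by
      rw [← zpow_natCast, ← zpow_mul, mul_comm, zpow_mul, zpow_natCast, hζ.pow_eq_one, one_zpow]
    simp [hpow]

/-- For `i < N`: `N ∣ (i - j)` over `ℤ` iff `i = j % N`. -/
theorem int_dvd_sub_iff_eq_mod {N : ℕ} {i : ℕ} (hi : i < N) (j : ℕ) :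
    (N : ℤ) ∣ ((i : ℤ) - j) ↔ i = j % N := by
  have hjmod : ((j % N : ℕ) : ℤ) = (j : ℤ) % (N : ℤ) := Int.natCast_mod j N
  constructor
  · rintro ⟨c, hc⟩
    have hi' : (i : ℤ) = j + N * c := by linarith
    have h1 : (i : ℤ) % N = (j : ℤ) % N := by
      rw [hi', Int.add_mul_emod_self_left]
    have h2 : (i : ℤ) % N = i := Int.emod_eq_of_lt (by positivity) (by exact_mod_cast hi)
    have h3 : (i : ℤ) = ((j % N : ℕ) : ℤ) := by rw [hjmod, ← h1, h2]
    exact_mod_cast h3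
  · rintro rfl
    rw [hjmod, Int.emod_def]
    exact ⟨-(↑j / ↑N), by ring⟩

/-- Fourier inversion on `ℤ/N` with an `N`-th primitive root of unity in a field:
`N · f j = ∑_a ζ^{-aj} · S(a)`, `S(a) = ∑_i ζ^{ai} f i`, for an `N`-periodic `f`. -/
theorem inversion {N : ℕ} (hN : 0 < N) {ζ : R} (hζ : IsPrimitiveRoot ζ N) (f : ℕ → R)
    (hf : Function.Periodic f N) (j : ℕ) :
    (N : R) * f j =
      ∑ a ∈ range N, ζ ^ (-((a * j : ℕ) : ℤ)) * ∑ i ∈ range N, (ζ ^ a) ^ i * f i := by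
  have hζ0 : ζ ≠ 0 := hζ.ne_zero hN.ne'
  -- rewrite each summand via integer exponents
  have key : ∀ a i : ℕ, ζ ^ (-((a * j : ℕ) : ℤ)) * ((ζ ^ a) ^ i * f i)
      = f i * (ζ ^ ((i : ℤ) - j)) ^ a := by
    intro a i
    have e1 : (ζ ^ a) ^ i = ζ ^ (((a * i : ℕ)) : ℤ) := by
      rw [zpow_natCast, pow_mul]
    have e2 : (ζ ^ ((i : ℤ) - j)) ^ a = ζ ^ (((i : ℤ) - j) * a) := by
      rw [← zpow_natCast, ← zpow_mul]
    rw [e1, e2]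
    have e3 : ((i : ℤ) - j) * a = -((a * j : ℕ) : ℤ) + ((a * i : ℕ) : ℤ) := by push_cast; ring
    rw [e3, zpow_add₀ hζ0]
    ring
  calc (N : R) * f j
      = ∑ i ∈ range N, f i * (if (N : ℤ) ∣ ((i : ℤ) - j) then (N : R) else 0) := by
        rw [Finset.sum_eq_single (j % N)]
        · have hmem : j % N < N := Nat.mod_lt _ hN
          rw [if_pos ((int_dvd_sub_iff_eq_mod hmem j).mpr rfl)]
          rw [show f (j % N) = f j from hf.map_mod_nat j]
          ring
        · intro i hi hne
          rw [if_neg (fun h => hne ((int_dvd_sub_iff_eq_mod (mem_range.mp hi) j).mp h))]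
          ring
        · intro h
          exact absurd (mem_range.mpr (Nat.mod_lt _ hN)) h
    _ = ∑ i ∈ range N, f i * ∑ a ∈ range N, (ζ ^ ((i : ℤ) - j)) ^ a := by
        refine sum_congr rfl fun i _ => ?_
        rw [geom_sum_zpow_eq hζ]
    _ = ∑ i ∈ range N, ∑ a ∈ range N, f i * (ζ ^ ((i : ℤ) - j)) ^ a := by
        refine sum_congr rfl fun i _ => ?_
        rw [mul_sum]
    _ = ∑ a ∈ range N, ∑ i ∈ range N, f i * (ζ ^ ((i : ℤ) - j)) ^ a := sum_comm
    _ = ∑ a ∈ range N, ζ ^ (-((a * j : ℕ) : ℤ)) * ∑ i ∈ range N, (ζ ^ a) ^ i * f i := by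
        refine sum_congr rfl fun a _ => ?_
        rw [mul_sum]
        exact sum_congr rfl fun i _ => (key a i).symm

/-- **Step (1) of the elementary T3.** If every PRIMITIVE twisted sum of an `N = 3^(n+1)`-periodic
`f` vanishes, then `f` is `3^n`-periodic. -/
theorem periodic_of_primitive_twisted_sums_eq_zero (n : ℕ) {ζ : R}
    (hζ : IsPrimitiveRoot ζ (3 ^ (n + 1))) (h3 : (3 : R) ≠ 0) (f : ℕ → R)
    (hf : Function.Periodic f (3 ^ (n + 1)))
    (h : ∀ a : ℕ, ¬ 3 ∣ a → ∑ i ∈ range (3 ^ (n + 1)), (ζ ^ a) ^ i * f i = 0) :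
    Function.Periodic f (3 ^ n) := by
  set N := 3 ^ (n + 1) with hNdef
  have hN : 0 < N := by positivity
  have hNM : N = 3 * 3 ^ n := by rw [hNdef, pow_succ, mul_comm]
  have hNR : (N : R) ≠ 0 := by
    rw [hNdef]; exact_mod_cast pow_ne_zero (n + 1) h3
  -- the inversion formula with the primitive terms removed
  have inv : ∀ j : ℕ, (N : R) * f j =
      ∑ a ∈ (range N).filter (fun a => 3 ∣ a),
        ζ ^ (-((a * j : ℕ) : ℤ)) * ∑ i ∈ range N, (ζ ^ a) ^ i * f i := by
    intro j
    rw [inversion hN hζ f hf j, ← sum_filter_add_sum_filter_not (range N) (fun a => 3 ∣ a)]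
    conv_rhs => rw [← add_zero (∑ a ∈ (range N).filter (fun a => 3 ∣ a), _)]
    congr 1
    refine sum_eq_zero fun a ha => ?_
    rw [(h a (mem_filter.mp ha).2), mul_zero]
  intro j
  have hshift : ∀ a ∈ (range N).filter (fun a => 3 ∣ a),
      ζ ^ (-((a * (j + 3 ^ n) : ℕ) : ℤ)) = ζ ^ (-((a * j : ℕ) : ℤ)) := by
    intro a ha
    obtain ⟨b, rfl⟩ := (mem_filter.mp ha).2
    have hζ0 : ζ ≠ 0 := hζ.ne_zero hN.ne'
    have e : -(((3 * b) * (j + 3 ^ n) : ℕ) : ℤ) = -(((3 * b) * j : ℕ) : ℤ) + (N : ℤ) * (-(b : ℤ)) := by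
      rw [hNM]; push_cast; ring
    rw [e, zpow_add₀ hζ0, zpow_mul, zpow_natCast, hζ.pow_eq_one, one_zpow, mul_one]
  have : (N : R) * f (j + 3 ^ n) = (N : R) * f j := by
    rw [inv, inv]
    exact sum_congr rfl fun a ha => by rw [hshift a ha]
  exact mul_left_cancel₀ hNR this

end Orthogonality

end Summit.BirchSwinnertonDyer.BirchSwinnertonDyer.Cruxes.TwinAlgMuZeroAtThree.TranscendenceTorsion

end
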